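import Summits.BirchSwinnertonDyer.BirchSwinnertonDyer.Theorems.AlignedTransportAtTwoMainConjectureOfRankZeroBSDAtTwoFineRoadTwoBranch
import HarnessLib

/-!
# Route `AlignedTransportAtTwo`, crux C2 `MainConjectureOfRankZeroBSDAtTwo` (stmt-BirchSwinnertonDyer-22298):
# road (b″) — `Δ`-COINVARIANTS FIRST: over `K = ℚ(i)` only the EVEN branch and the fine Selmer group
# survive the descent to `ℚ_∞` (pure commutative algebra)

HONEST FRAMING (cell `bsd-f1-sign2`, lead prover seat `bsd-line-att-p2` gen 2; BSD is NOT proved by any of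
this). THEOREMS ONLY, pure module theory; nothing about elliptic curves is asserted. Third sibling of
`…FineRoad` (road (b): over `ℚ_∞`, construction target at `(2)`) and `…FineRoadTwoBranch` (road (b′): over
`K = ℚ(i)`, BOTH branches `a ± b` of `𝔏(z_{c,d}) = a + bc ∈ Λ_G = Λ₀[Δ]` enter). Road (b″) takes
`Δ`-coinvariants of Kato's row over `ℚ(ζ_{2^∞})` BEFORE the length bookkeeping: the functor `M ↦ M_Δ =
M/(c − 1)M` is right exact, `(Λ_G/(a + bc))_Δ = Λ₀/(a + b)` sees ONLY the even branch `χ₊`, and the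
Pontryagin dual of `Sel(E/ℚ_∞)` is `X(E/K_∞)_Δ` up to finite modules (restriction–inflation along
`K_∞ = ℚ_∞(i)`). So the odd-branch hypothesis (Mu⁻) of road (b′) DISAPPEARS:

* §1 coinvariants `M ⧸ range e` of a module with an endomorphism `e` (`= c − 1`): functoriality
  (`range_le_comap_range_of_comm`), RIGHT EXACTNESS (`exact_mapQ_range_of_exact`, `mapQ_range_surjective`)
  and the length form `lengthAt_coinv_le_of_exact`: `ℓ(B_Δ) ≤ ℓ(A_Δ) + ℓ(C_Δ)` along `A → B → C → 0`.
* §2 `lengthAt_coinv_le_of_injective`: for an equivariant EMBEDDING `ι : P ↪ F` and any `L ≤ P`,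
  `ℓ(P/(L + e_P P)) ≤ ℓ(F/ιP) + ℓ(F/(ιL + e_F F))` — the kernel of `P_Δ → F_Δ` is a subquotient of the
  cokernel `F/ιP` (snake lemma for `c − 1`, written out); with Kato's finite cokernel (Prop. 17.11) the
  first term dies at every height-one prime.
* §3 `lengthAt_quotient_span_sup_range_swap`: `ℓ(R²/(⟨(a,b),(b,a)⟩ + (σ − 1)R²)) = ℓ(R/(a+b))` for the swap
  `σ` — the `Δ`-coinvariants of `Λ_G/(a + bc)Λ_G` are `Λ₀/(χ₊(a + bc))`.
* §4 `lengthAt_coinv_le_of_roadB2`: for the row `P → X → Y → 0` with `Δ`-action, an injective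
  `σ`-equivariant Coleman map `col : P → R × R` and the two zeta images `(a,b)`, `(b,a)` in `ker toX`:
  `ℓ(X_Δ) ≤ ℓ(R²/col P) + ℓ(R/(a+b)) + ℓ(Y_Δ)`.

Reading at `p = 2` (sibling `…FineRoadCoinvCrux`): `X = X(E/K_∞)`, `Y = X₀(E/K_∞)`, `K = ℚ(i)`;
`X_Δ → X(E/ℚ_∞)` has finite cokernel; `Y_Δ ← → X₀(E/ℚ_∞)` differ by finite modules when `Δ_E < 0` (no
real `2`-torsion cohomology: `H¹(ℝ, E[2^∞]) = 0`), and by the archimedean `(Λ/2)`-term when `Δ_E > 0`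
(Greenberg's strict/relaxed phenomenon at `2`, to be cancelled against the same term in `X`); `a + b =
χ₊(𝔏(z_{c,d})) = s₊·G₊` with `G₊` the integral lift of `L₂(f, α)` and `μ(s₊) = 0` — so `μ(X(E/ℚ_∞)) ≤
μ(L₂(E,T)) + μ(X₀(E/ℚ_∞))` modulo printed statements at `2` (typing + the `×2` audit of (17.13.1)) — the
SAME inequality Kato's 12.5 (4) gives at odd `p`, now without any Euler-system bound at `(2)`.

References: K. Kato, Astérisque 295 (2004), §12.1, Thm. 12.6, (14.9.3), Thm. 16.6, Prop. 17.11, §17.13;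
R. Greenberg, LNM 1716 (1999) §3–§4 (restriction in the cyclotomic tower; the real places at `p = 2`);
J. Coates, R. Sujatha, Math. Ann. 331 (2005) §3; L. Washington, GTM 83, §13.2.
-/

set_option linter.dupNamespace false
set_option autoImplicit false

noncomputable section

open scoped Classical

open Literature.NumberTheory.EllipticCurves Literature.NumberTheory.EllipticCurves.Module

namespace Summit.BirchSwinnertonDyer.BirchSwinnertonDyer.Theorems.AlignedTransportAtTwoFineRoad

/-! ## §1 Coinvariants `M_Δ = M ⧸ (c − 1)M` of a module with an endomorphism: functoriality and right exactness -/

section Coinv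

variable {R : Type*} [CommRing R] {A B C : Type*} [AddCommGroup A] [_root_.Module R A]
  [AddCommGroup B] [_root_.Module R B] [AddCommGroup C] [_root_.Module R C]

/-- An `R`-linear map intertwining two endomorphisms maps the range of the first into the range of the
second (so it descends to the coinvariants `M ⧸ range e`). [folklore] -/
theorem range_le_comap_range_of_comm (f : A →ₗ[R] B) (eA : A →ₗ[R] A) (eB : B →ₗ[R] B)
    (h : f ∘ₗ eA = eB ∘ₗ f) : LinearMap.range eA ≤ Submodule.comap f (LinearMap.range eB) := by
  rintro _ ⟨a, rfl⟩
  refine ⟨f a, ?_⟩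
  change (eB ∘ₗ f) a = (f ∘ₗ eA) a
  rw [h]

/-- **Right exactness of coinvariants.** If `A → B → C → 0` is exact (`Exact f g`, `g` onto) and `f, g`
intertwine endomorphisms `e_A, e_B, e_C` (the action of `c − 1` for an automorphism `c` of order two, say),
then the induced sequence of coinvariants `A/e_A A → B/e_B B → C/e_C C → 0` is exact at the middle
(and the last map is onto). [folklore] -/
theorem exact_mapQ_range_of_exact (f : A →ₗ[R] B) (g : B →ₗ[R] C) (eA : A →ₗ[R] A) (eB : B →ₗ[R] B)
    (eC : C →ₗ[R] C) (hf : f ∘ₗ eA = eB ∘ₗ f) (hg : g ∘ₗ eB = eC ∘ₗ g) (hfg : Function.Exact f g)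
    (hgs : Function.Surjective g) :
    Function.Exact
      (Submodule.mapQ (LinearMap.range eA) (LinearMap.range eB) f (range_le_comap_range_of_comm f eA eB hf))
      (Submodule.mapQ (LinearMap.range eB) (LinearMap.range eC) g
        (range_le_comap_range_of_comm g eB eC hg)) := by
  rw [LinearMap.exact_iff]
  apply le_antisymm
  · intro x hx
    obtain ⟨b, rfl⟩ := Submodule.Quotient.mk_surjective _ x
    rw [LinearMap.mem_ker, Submodule.mapQ_apply, Submodule.Quotient.mk_eq_zero] at hx
    obtain ⟨c', hc'⟩ := hx
    obtain ⟨b', rfl⟩ := hgs c'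
    have hmem : b - eB b' ∈ LinearMap.ker g := by
      rw [LinearMap.mem_ker, map_sub, sub_eq_zero, ← hc']
      change (eC ∘ₗ g) b' = (g ∘ₗ eB) b'
      rw [hg]
    rw [LinearMap.exact_iff] at hfg
    rw [hfg] at hmem
    obtain ⟨a, ha⟩ := hmem
    refine ⟨Submodule.Quotient.mk a, ?_⟩
    rw [Submodule.mapQ_apply, ha, Submodule.Quotient.mk_sub]
    have h0 : (Submodule.Quotient.mk (eB b') : B ⧸ LinearMap.range eB) = 0 :=
      (Submodule.Quotient.mk_eq_zero _).mpr ⟨b', rfl⟩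
    rw [h0, sub_zero]
  · rintro _ ⟨x, rfl⟩
    obtain ⟨a, rfl⟩ := Submodule.Quotient.mk_surjective _ x
    rw [LinearMap.mem_ker, Submodule.mapQ_apply, Submodule.mapQ_apply, hfg.apply_apply_eq_zero,
      Submodule.Quotient.mk_zero]

/-- Coinvariants of an onto map are onto. [folklore] -/
theorem mapQ_range_surjective (g : B →ₗ[R] C) (eB : B →ₗ[R] B) (eC : C →ₗ[R] C)
    (hg : g ∘ₗ eB = eC ∘ₗ g) (hgs : Function.Surjective g) :
    Function.Surjective (Submodule.mapQ (LinearMap.range eB) (LinearMap.range eC) g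
      (range_le_comap_range_of_comm g eB eC hg)) := by
  intro y
  obtain ⟨c, rfl⟩ := Submodule.Quotient.mk_surjective _ y
  obtain ⟨b, rfl⟩ := hgs c
  exact ⟨Submodule.Quotient.mk b, rfl⟩

/-- **Length of coinvariants along a right-exact row**: `ℓ_𝔭(B_Δ) ≤ ℓ_𝔭(A_Δ) + ℓ_𝔭(C_Δ)`. [folklore] -/
theorem lengthAt_coinv_le_of_exact (f : A →ₗ[R] B) (g : B →ₗ[R] C) (eA : A →ₗ[R] A) (eB : B →ₗ[R] B)
    (eC : C →ₗ[R] C) (hf : f ∘ₗ eA = eB ∘ₗ f) (hg : g ∘ₗ eB = eC ∘ₗ g) (hfg : Function.Exact f g)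
    (hgs : Function.Surjective g) (𝔭 : PrimeSpectrum R) :
    lengthAt R (B ⧸ LinearMap.range eB) 𝔭 ≤
      lengthAt R (A ⧸ LinearMap.range eA) 𝔭 + lengthAt R (C ⧸ LinearMap.range eC) 𝔭 :=
  lengthAt_le_add_of_exact _ _ (exact_mapQ_range_of_exact f g eA eB eC hf hg hfg hgs) 𝔭

end Coinv

/-! ## §2 Coinvariants of a submodule of finite index: `ℓ(P_Δ) ≤ ℓ(F ⧸ P) + ℓ(F_Δ)` along an
equivariant embedding `ι : P ↪ F` (the kernel of `P_Δ → F_Δ` is a subquotient of `F ⧸ P`) -/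

section FiniteIndex

variable {R : Type*} [CommRing R] {P F : Type*} [AddCommGroup P] [_root_.Module R P]
  [AddCommGroup F] [_root_.Module R F]

/-- **Coinvariants of an equivariant embedding, with a stable submodule quotiented out.** `ι : P ↪ F`
intertwining `e_P, e_F`, `L ≤ P` any submodule. Then
`ℓ_𝔭(P ⧸ (L + e_P P)) ≤ ℓ_𝔭(F ⧸ ι(P)) + ℓ_𝔭(F ⧸ (ι(L) + e_F F))`: the kernel of
`P/(L + e_P P) → F/(ι L + e_F F)` is the image under `e_F` (pulled back through `ι`) of
`{x ∈ F : e_F x ∈ ι(P)} ⊇ ι(P)`, a subquotient of `F ⧸ ι(P)`. (Snake lemma for `c − 1` on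
`0 → P → F → F/P → 0`, written out.) [folklore] -/
theorem lengthAt_coinv_le_of_injective (ι : P →ₗ[R] F) (hι : Function.Injective ι) (eP : P →ₗ[R] P)
    (eF : F →ₗ[R] F) (h : ι ∘ₗ eP = eF ∘ₗ ι) (L : Submodule R P) (𝔭 : PrimeSpectrum R) :
    lengthAt R (P ⧸ (L ⊔ LinearMap.range eP)) 𝔭 ≤
      lengthAt R (F ⧸ LinearMap.range ι) 𝔭 +
        lengthAt R (F ⧸ (Submodule.map ι L ⊔ LinearMap.range eF)) 𝔭 := by
  set SP : Submodule R P := L ⊔ LinearMap.range eP with hSP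
  set SF : Submodule R F := Submodule.map ι L ⊔ LinearMap.range eF with hSF
  -- the induced map `q : P/SP → F/SF`
  have hle : SP ≤ Submodule.comap ι SF := by
    rw [hSP, hSF]
    refine sup_le (fun x hx => Submodule.mem_sup_left (Submodule.mem_map_of_mem hx)) ?_
    exact (range_le_comap_range_of_comm ι eP eF h).trans (Submodule.comap_mono le_sup_right)
  let q : (P ⧸ SP) →ₗ[R] (F ⧸ SF) := Submodule.mapQ SP SF ι hle
  -- `T = e_F⁻¹(ι P)` and the map `j : T → P/SP`, `x ↦ [ι⁻¹ (e_F x)]`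
  set T : Submodule R F := Submodule.comap eF (LinearMap.range ι) with hT
  let ιe : P ≃ₗ[R] LinearMap.range ι := LinearEquiv.ofInjective ι hι
  let eT : T →ₗ[R] LinearMap.range ι :=
    { toFun := fun x => ⟨eF x, x.2⟩
      map_add' := fun x y => by ext; simp
      map_smul' := fun r x => by ext; simp }
  let j0 : T →ₗ[R] (P ⧸ SP) := SP.mkQ ∘ₗ (ιe.symm : LinearMap.range ι →ₗ[R] P) ∘ₗ eT
  have hιe : ∀ (x : T), ι (ιe.symm (eT x)) = eF x := fun x => by
    have h1 := congrArg Subtype.val (ιe.apply_symm_apply (eT x))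
    rw [LinearEquiv.ofInjective_apply] at h1
    exact h1
  -- `j0` kills `T ⊓ ι(P)` pulled back: if `x = ι p` then `e_F x = ι (e_P p)` and `[e_P p] = 0`
  have hj0 : Submodule.comap T.subtype (LinearMap.range ι) ≤ LinearMap.ker j0 := by
    rintro x ⟨p, hp⟩
    rw [LinearMap.mem_ker]
    change SP.mkQ (ιe.symm (eT x)) = 0
    have hp' : ι p = (x : F) := hp
    have hx : ιe.symm (eT x) = eP p := by
      apply hι
      rw [hιe, ← hp']
      change (eF ∘ₗ ι) p = (ι ∘ₗ eP) p
      rw [h]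
    rw [hx, Submodule.mkQ_apply, Submodule.Quotient.mk_eq_zero, hSP]
    exact Submodule.mem_sup_right ⟨p, rfl⟩
  let j : (T ⧸ Submodule.comap T.subtype (LinearMap.range ι)) →ₗ[R] (P ⧸ SP) :=
    (Submodule.comap T.subtype (LinearMap.range ι)).liftQ j0 hj0
  -- exactness of `T/(T ∩ ιP) → P/SP → F/SF` at the middle
  have hexact : Function.Exact j q := by
    rw [LinearMap.exact_iff]
    apply le_antisymm
    · intro y hy
      obtain ⟨p, rfl⟩ := Submodule.Quotient.mk_surjective _ y
      rw [LinearMap.mem_ker, Submodule.mapQ_apply, Submodule.Quotient.mk_eq_zero, hSF,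
        Submodule.mem_sup] at hy
      obtain ⟨l', hl', w, ⟨x, rfl⟩, hsum⟩ := hy
      obtain ⟨l, hl, rfl⟩ := hl'
      -- `e_F x = ι (p - l)`, so `x ∈ T` and `j [x] = [p - l] = [p]`
      have hxT : x ∈ T := by
        rw [hT, Submodule.mem_comap]
        exact ⟨p - l, by rw [map_sub, ← hsum]; abel⟩
      refine ⟨Submodule.Quotient.mk ⟨x, hxT⟩, ?_⟩
      rw [Submodule.liftQ_apply]
      change SP.mkQ (ιe.symm (eT ⟨x, hxT⟩)) = Submodule.Quotient.mk p
      have hx : ιe.symm (eT ⟨x, hxT⟩) = p - l := by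
        apply hι
        rw [hιe, map_sub, ← hsum]
        change eF x = ι l + eF x - ι l
        abel
      rw [hx, Submodule.mkQ_apply, Submodule.Quotient.mk_sub, sub_eq_self,
        Submodule.Quotient.mk_eq_zero, hSP]
      exact Submodule.mem_sup_left hl
    · rintro _ ⟨y, rfl⟩
      obtain ⟨x, rfl⟩ := Submodule.Quotient.mk_surjective _ y
      rw [LinearMap.mem_ker, Submodule.liftQ_apply]
      change q (SP.mkQ (ιe.symm (eT x))) = 0
      rw [Submodule.mkQ_apply]
      change Submodule.mapQ SP SF ι hle (Submodule.Quotient.mk _) = 0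
      rw [Submodule.mapQ_apply, Submodule.Quotient.mk_eq_zero, hιe, hSF]
      exact Submodule.mem_sup_right ⟨x, rfl⟩
  -- `T/(T ∩ ιP) ↪ F/ιP`
  have hinj : Function.Injective
      (Submodule.mapQ (Submodule.comap T.subtype (LinearMap.range ι)) (LinearMap.range ι) T.subtype
        le_rfl) := by
    rw [← LinearMap.ker_eq_bot, Submodule.ker_mapQ, Submodule.mkQ_map_self]
  calc lengthAt R (P ⧸ SP) 𝔭
      ≤ lengthAt R (T ⧸ Submodule.comap T.subtype (LinearMap.range ι)) 𝔭 + lengthAt R (F ⧸ SF) 𝔭 :=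
        lengthAt_le_add_of_exact j q hexact 𝔭
    _ ≤ lengthAt R (F ⧸ LinearMap.range ι) 𝔭 + lengthAt R (F ⧸ SF) 𝔭 := by
        gcongr
        exact lengthAt_le_of_injective _ hinj 𝔭

end FiniteIndex

/-! ## §3 The `Δ`-coinvariants of `Λ_G/(a + bc)Λ_G`: `R²/(⟨(a,b),(b,a)⟩ + (swap − 1)R²) ≅ R/(a+b)` -/

section Swap

variable {R : Type*} [CommRing R]

/-- **Coinvariants of the two-branch quotient see only the EVEN branch**: for the swap `σ` of `R × R`
(the action of the generator `c` of `Δ` on `Λ_G = Λ₀ ⊕ Λ₀c`),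
`ℓ_𝔭(R²/(⟨(a,b),(b,a)⟩ + (σ − 1)R²)) = ℓ_𝔭(R/(a+b))` — via the sum map `(x,y) ↦ x + y` (the character
`χ₊ : Λ_G → Λ₀`, `c ↦ 1`). The odd branch `a − b` does NOT appear. [cite: Kato2004Asterisque, §12.1 (pp. 219–220)] -/
theorem lengthAt_quotient_span_sup_range_swap (a b : R) (𝔭 : PrimeSpectrum R) :
    lengthAt R ((R × R) ⧸ (Submodule.span R ({(a, b), (b, a)} : Set (R × R)) ⊔
      LinearMap.range ((LinearEquiv.prodComm R R R : R × R →ₗ[R] R × R) - LinearMap.id))) 𝔭 =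
      lengthAt R (R ⧸ Ideal.span {a + b}) 𝔭 := by
  set N : Submodule R (R × R) := Submodule.span R ({(a, b), (b, a)} : Set (R × R)) with hN
  set e : R × R →ₗ[R] R × R := (LinearEquiv.prodComm R R R : R × R →ₗ[R] R × R) - LinearMap.id
    with he
  let sm : R × R →ₗ[R] R := LinearMap.fst R R R + LinearMap.snd R R R
  have hesm : ∀ v : R × R, sm (e v) = 0 := fun v => by
    simp only [sm, he, LinearMap.sub_apply, LinearEquiv.coe_coe,
      LinearEquiv.prodComm_apply, LinearMap.id_coe, id_eq, LinearMap.add_apply, LinearMap.fst_apply,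
      LinearMap.snd_apply, Prod.fst_sub, Prod.snd_sub, Prod.fst_swap, Prod.snd_swap]
    ring
  have hker : LinearMap.ker ((Ideal.span {a + b}).mkQ ∘ₗ sm) = N ⊔ LinearMap.range e := by
    apply le_antisymm
    · intro v hv
      rw [LinearMap.mem_ker, LinearMap.comp_apply, Submodule.mkQ_apply,
        Submodule.Quotient.mk_eq_zero, Ideal.mem_span_singleton] at hv
      obtain ⟨r, hr⟩ := hv
      have hsv : v.1 + v.2 = (a + b) * r := hr
      have hn : r • ((a, b) : R × R) ∈ N := N.smul_mem r (Submodule.subset_span (by simp))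
      have hw : v - r • ((a, b) : R × R) ∈ LinearMap.range e := by
        refine ⟨((0 : R), v.1 - r * a), ?_⟩
        change (((LinearEquiv.prodComm R R R) ((0 : R), v.1 - r * a)) - ((0 : R), v.1 - r * a)
          : R × R) = v - r • ((a, b) : R × R)
        ext
        · simp
        · simp only [LinearEquiv.prodComm_apply, Prod.swap_prod_mk, Prod.snd_sub, Prod.smul_snd,
            smul_eq_mul]
          linear_combination -hsv
      have : v = r • ((a, b) : R × R) + (v - r • (a, b)) := by abel
      rw [this]
      exact Submodule.add_mem_sup hn hw
    · refine sup_le ?_ ?_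
      · rw [hN, Submodule.span_le]
        rintro v hv
        simp only [Set.mem_insert_iff, Set.mem_singleton_iff] at hv
        rw [SetLike.mem_coe, LinearMap.mem_ker, LinearMap.comp_apply, Submodule.mkQ_apply,
          Submodule.Quotient.mk_eq_zero, Ideal.mem_span_singleton]
        rcases hv with rfl | rfl
        · exact ⟨1, by change a + b = (a + b) * 1; ring⟩
        · exact ⟨1, by change b + a = (a + b) * 1; ring⟩
      · rintro _ ⟨v, rfl⟩
        rw [LinearMap.mem_ker, LinearMap.comp_apply, hesm, map_zero]
  have hsurj : Function.Surjective ((Ideal.span {a + b}).mkQ ∘ₗ sm) := by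
    intro q
    obtain ⟨x, rfl⟩ := Submodule.mkQ_surjective _ q
    exact ⟨(x, 0), by simp [sm]⟩
  exact lengthAt_eq_of_linearEquiv
    ((Submodule.quotEquivOfEq _ _ hker.symm).trans (LinearMap.quotKerEquivOfSurjective _ hsurj)) 𝔭

end Swap

/-! ## §4 ROAD (b″): coinvariants first — only the EVEN branch and the fine Selmer group survive -/

section RoadB2

variable {R : Type*} [CommRing R]
  {P X Y : Type*} [AddCommGroup P] [_root_.Module R P] [AddCommGroup X] [_root_.Module R X]
  [AddCommGroup Y] [_root_.Module R Y]

/-- **Road (b″), abstract form.** Row `P → X → Y → 0` exact (`Exact toX π`, `π` onto) of modules with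
endomorphisms `c_P, c_X, c_Y` (the `Δ`-action) intertwined by `toX, π`; an injective Coleman map
`col : P → R × R` with `col ∘ c_P = σ ∘ col` (`σ` = swap: `Λ_G = Λ₀ ⊕ Λ₀c` with `c` acting by swap); two
elements `w₁, w₂ ∈ ker toX` (the images of `z_{c,d}` and `c·z_{c,d}`) with `col w₁ = (a,b)`, `col w₂ = (b,a)`.
Then for the `Δ`-COINVARIANTS:
`ℓ_𝔭(X/(c_X − 1)X) ≤ ℓ_𝔭(R²/col(P)) + ℓ_𝔭(R/(a+b)) + ℓ_𝔭(Y/(c_Y − 1)Y)` — only the even branch `a + b`.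
[cite: Kato2004Asterisque, §12.1 and §17.13 (pp. 219–220, 279–280)] -/
theorem lengthAt_coinv_le_of_roadB2 (toX : P →ₗ[R] X) (π : X →ₗ[R] Y) (hX : Function.Exact toX π)
    (hπ : Function.Surjective π) (cP : P →ₗ[R] P) (cX : X →ₗ[R] X) (cY : Y →ₗ[R] Y)
    (hcX : toX ∘ₗ cP = cX ∘ₗ toX) (hcY : π ∘ₗ cX = cY ∘ₗ π) (col : P →ₗ[R] R × R)
    (hcol : Function.Injective col)
    (hccol : col ∘ₗ cP = (LinearEquiv.prodComm R R R : R × R →ₗ[R] R × R) ∘ₗ col)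
    {w₁ w₂ : P} (h₁ : toX w₁ = 0) (h₂ : toX w₂ = 0) {a b : R} (hw₁ : col w₁ = (a, b))
    (hw₂ : col w₂ = (b, a)) (𝔭 : PrimeSpectrum R) :
    lengthAt R (X ⧸ LinearMap.range (cX - 1)) 𝔭 ≤
      lengthAt R ((R × R) ⧸ LinearMap.range col) 𝔭 + lengthAt R (R ⧸ Ideal.span {a + b}) 𝔭 +
        lengthAt R (Y ⧸ LinearMap.range (cY - 1)) 𝔭 := by
  set σ : R × R →ₗ[R] R × R := (LinearEquiv.prodComm R R R : R × R →ₗ[R] R × R) with hσ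
  set LZ : Submodule R P := Submodule.span R {w₁, w₂} with hLZ
  -- `c_P` swaps `w₁, w₂`
  have hc₁ : cP w₁ = w₂ := hcol (by
    change (col ∘ₗ cP) w₁ = col w₂
    rw [hccol, LinearMap.comp_apply, hw₁, hw₂]; rfl)
  have hc₂ : cP w₂ = w₁ := hcol (by
    change (col ∘ₗ cP) w₂ = col w₁
    rw [hccol, LinearMap.comp_apply, hw₁, hw₂]; rfl)
  set eP : P →ₗ[R] P := cP - 1 with heP
  set eX : X →ₗ[R] X := cX - 1 with heX
  set eY : Y →ₗ[R] Y := cY - 1 with heY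
  have hLZe : LZ ≤ Submodule.comap eP LZ := by
    rw [hLZ, Submodule.span_le]
    intro w hw
    simp only [Set.mem_insert_iff, Set.mem_singleton_iff] at hw
    rw [SetLike.mem_coe, Submodule.mem_comap, heP, LinearMap.sub_apply, Module.End.one_apply]
    rcases hw with rfl | rfl
    · rw [hc₁]
      exact Submodule.sub_mem _ (Submodule.subset_span (by simp)) (Submodule.subset_span (by simp))
    · rw [hc₂]
      exact Submodule.sub_mem _ (Submodule.subset_span (by simp)) (Submodule.subset_span (by simp))
  -- the row `P/LZ → X → Y`, with endomorphism `eA` on `A = P/LZ`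
  have hle : LZ ≤ LinearMap.ker toX := by
    rw [hLZ, Submodule.span_le]
    intro w hw
    simp only [Set.mem_insert_iff, Set.mem_singleton_iff] at hw
    rcases hw with rfl | rfl <;> simpa
  let f' : (P ⧸ LZ) →ₗ[R] X := LZ.liftQ toX hle
  have hf' : Function.Exact f' π := by
    rw [LinearMap.exact_iff, Submodule.range_liftQ]
    exact LinearMap.exact_iff.mp hX
  let eA : (P ⧸ LZ) →ₗ[R] (P ⧸ LZ) := Submodule.mapQ LZ LZ eP hLZe
  have heqX : toX ∘ₗ eP = eX ∘ₗ toX := by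
    rw [heP, heX, LinearMap.comp_sub, LinearMap.sub_comp, hcX]; rfl
  have hfA : f' ∘ₗ eA = eX ∘ₗ f' := by
    apply LinearMap.ext
    intro x
    obtain ⟨p, rfl⟩ := Submodule.Quotient.mk_surjective _ x
    change toX (eP p) = eX (toX p)
    exact LinearMap.congr_fun heqX p
  have hπe : π ∘ₗ eX = eY ∘ₗ π := by
    rw [heX, heY, LinearMap.comp_sub, LinearMap.sub_comp, hcY]; rfl
  have step1 := lengthAt_coinv_le_of_exact f' π eA eX eY hfA hπe hf' hπ 𝔭
  -- `A/eA A ≅ P/(LZ ⊔ range eP)`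
  have hrange : LinearMap.range eA = Submodule.map LZ.mkQ (LZ ⊔ LinearMap.range eP) := by
    rw [Submodule.map_sup, Submodule.mkQ_map_self, bot_sup_eq]
    change LinearMap.range (LZ.liftQ (LZ.mkQ ∘ₗ eP) _) = _
    rw [Submodule.range_liftQ, LinearMap.range_comp]
  have step2 : lengthAt R ((P ⧸ LZ) ⧸ LinearMap.range eA) 𝔭 =
      lengthAt R (P ⧸ (LZ ⊔ LinearMap.range eP)) 𝔭 :=
    lengthAt_eq_of_linearEquiv ((Submodule.quotEquivOfEq _ _ hrange).trans
      (Submodule.quotientQuotientEquivQuotient LZ (LZ ⊔ LinearMap.range eP) le_sup_left)) 𝔭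
  -- §2 along `col`
  have hcole : col ∘ₗ eP = (σ - LinearMap.id) ∘ₗ col := by
    rw [heP, LinearMap.comp_sub, LinearMap.sub_comp, hccol]; rfl
  have step3 := lengthAt_coinv_le_of_injective col hcol eP (σ - LinearMap.id) hcole LZ 𝔭
  -- `col(LZ) = ⟨(a,b),(b,a)⟩` and §3
  have hmap : Submodule.map col LZ = Submodule.span R ({(a, b), (b, a)} : Set (R × R)) := by
    rw [hLZ, Submodule.map_span, Set.image_pair, hw₁, hw₂]
  have step4 := lengthAt_quotient_span_sup_range_swap a b 𝔭
  rw [← hmap] at step4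
  rw [step4] at step3
  calc lengthAt R (X ⧸ LinearMap.range eX) 𝔭
      ≤ lengthAt R ((P ⧸ LZ) ⧸ LinearMap.range eA) 𝔭 + lengthAt R (Y ⧸ LinearMap.range eY) 𝔭 := step1
    _ = lengthAt R (P ⧸ (LZ ⊔ LinearMap.range eP)) 𝔭 + lengthAt R (Y ⧸ LinearMap.range eY) 𝔭 := by
        rw [step2]
    _ ≤ (lengthAt R ((R × R) ⧸ LinearMap.range col) 𝔭 + lengthAt R (R ⧸ Ideal.span {a + b}) 𝔭) +
          lengthAt R (Y ⧸ LinearMap.range eY) 𝔭 := by gcongr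

end RoadB2

end Summit.BirchSwinnertonDyer.BirchSwinnertonDyer.Theorems.AlignedTransportAtTwoFineRoad

end
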